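import Summits.QuantumFields.QCD.Theorems.SpectralDefectExtinctionWindowExtinctionSpreadTelescope
import Summits.QuantumFields.QCD.Theorems.SpectralDefectExtinctionWindowExtinctionSpreadPattern

/-!
# Patterns of mixed configurations: chains, antichains, weighted antichain bound

Helper (1/2) for stub `stub_fiberAtomMonotone` (S4″, reshape r3) of line
`free-volume-heavy-witness` (crux
`Summit.QuantumFields.QCD.Theses.SpectralDefectExtinction.WindowExtinction`,
item stmt-QuantumFields-8964).  Pure combinatorics, no project vocabulary.

For two "representative" configurations `qp ∈ Tp^J`, `qm ∈ Tm^J` and a pattern `σ : J → Bool`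
the MIXED configuration is `q^σ_i = qp_i` if `σ i` and `qm_i` otherwise.

* `fam_mix_chain`, `fam_mix_antichain` — if an integer statistic `Y` increases by at least one
  under every single `Tm → Tp` refill of an active configuration, then `σ ↦ Y(q^σ)` increases by
  at least the number of raised bits along the coordinatewise order, so its level sets are
  ANTICHAINS of the cube `J → Bool`;
* `fam_antichain_product` — the weighted antichain (Sperner/LYM) hypothesis, stated for `Fin N`
  and biases `pᵢ ∈ [ε, 1-ε]`, in product form over any finite index type (the analogue of the
  landed `spread_lo_product`).
-/

namespace Summit.QuantumFields.QCD.Cruxes.WindowExtinction.FreeVolumeHeavyWitness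

open Function
open scoped BigOperators Classical

/-! ## Combinatorics of mixed configurations -/

/-- Updating one refilled coordinate is refilling with the updated values. -/
theorem fam_update_updateFinset {I T : Type*} [DecidableEq I] (r : I → T) (S' : Finset I)
    (q : ↥S' → T) (i : ↥S') (u : T) :
    Function.update (updateFinset r S' q) i u = updateFinset r S' (Function.update q i u) := by
  funext k
  by_cases hk : k = (i : I)
  · subst hk
    simp [updateFinset, i.2]
  · rw [Function.update_of_ne hk]
    by_cases hkS : k ∈ S'
    · have hne : (⟨k, hkS⟩ : ↥S') ≠ i := fun h => hk (congrArg Subtype.val h)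
      simp [updateFinset, hkS, Function.update_of_ne hne]
    · simp [updateFinset, hkS]

/-- **Chains of patterns.** If `Y` increases by at least one under every single `Tm → Tp` refill
of an active configuration, then along the coordinatewise order of patterns the mixed
configuration `q^σ = (σ ? qp : qm)` of representatives `qp ∈ Tp^J`, `qm ∈ Tm^J` has `Y`
increasing by at least the number of raised bits. -/
theorem fam_mix_chain {J T : Type*} [Fintype J] [DecidableEq J] {Tp Tm : Set T}
    {Y : (J → T) → ℤ}
    (hmono : ∀ q : J → T, (∀ i, q i ∈ Tp ∪ Tm) → ∀ i, ∀ u ∈ Tp, q i ∈ Tm →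
      Y q + 1 ≤ Y (Function.update q i u))
    (qp qm : J → T) (hqp : ∀ i, qp i ∈ Tp) (hqm : ∀ i, qm i ∈ Tm) :
    ∀ (k : ℕ) (σ σ' : J → Bool), (∀ i, σ i ≤ σ' i) →
      (Finset.univ.filter fun i => σ i ≠ σ' i).card = k →
      Y (fun i => if σ i then qp i else qm i) + (k : ℤ) ≤
        Y (fun i => if σ' i then qp i else qm i) := by
  intro k
  induction k with
  | zero =>
    intro σ σ' _ hk
    have hσσ : σ = σ' := by
      funext i
      by_contra hne
      have hi : i ∈ Finset.univ.filter fun i => σ i ≠ σ' i := by simpa using hne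
      rw [Finset.card_eq_zero.1 hk] at hi
      simp at hi
    subst hσσ
    simp
  | succ k ih =>
    intro σ σ' hle hk
    obtain ⟨a, ha⟩ : (Finset.univ.filter fun i => σ i ≠ σ' i).Nonempty := by
      rw [← Finset.card_pos, hk]; exact Nat.succ_pos k
    have ha' : σ a ≠ σ' a := by simpa using ha
    have key : σ a = false ∧ σ' a = true := by
      have h1 := hle a
      rw [Bool.le_iff_imp] at h1
      cases hx : σ a <;> cases hy : σ' a <;> simp_all
    obtain ⟨hσa, hσ'a⟩ := key
    set σ₁ : J → Bool := Function.update σ a true with hσ₁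
    have hle₁ : ∀ i, σ₁ i ≤ σ' i := by
      intro i
      by_cases hi : i = a
      · subst hi; simp [hσ₁, hσ'a]
      · simp only [hσ₁, Function.update_of_ne hi]; exact hle i
    have hcard : (Finset.univ.filter fun i => σ₁ i ≠ σ' i).card = k := by
      have hset : (Finset.univ.filter fun i => σ₁ i ≠ σ' i) =
          (Finset.univ.filter fun i => σ i ≠ σ' i).erase a := by
        ext i
        by_cases hi : i = a
        · subst hi; simp [hσ₁, hσ'a]
        · simp [hσ₁, hi]
      rw [hset, Finset.card_erase_of_mem ha, hk]
      rfl
    have hstep : Y (fun i => if σ i then qp i else qm i) + 1 ≤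
        Y (fun i => if σ₁ i then qp i else qm i) := by
      have hupd : (fun i => if σ₁ i then qp i else qm i) =
          Function.update (fun i => if σ i then qp i else qm i) a (qp a) := by
        funext i
        by_cases hi : i = a
        · subst hi; simp [hσ₁]
        · simp [hσ₁, Function.update_of_ne hi]
      rw [hupd]
      refine hmono _ (fun i => ?_) a (qp a) (hqp a) ?_
      · show (if σ i then qp i else qm i) ∈ Tp ∪ Tm
        split_ifs
        exacts [Or.inl (hqp i), Or.inr (hqm i)]
      · show (if σ a then qp a else qm a) ∈ Tm
        simp [hσa, hqm a]
    have hih := ih σ₁ σ' hle₁ hcard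
    push_cast
    linarith

/-- **Level sets of the mixed statistic are antichains.** With `Y`, `qp`, `qm` as in
`fam_mix_chain`, two comparable patterns whose mixed configurations lie in the same atom of `Y`
are equal. -/
theorem fam_mix_antichain {J T : Type*} [Fintype J] [DecidableEq J] {Tp Tm : Set T}
    {Y : (J → T) → ℤ}
    (hmono : ∀ q : J → T, (∀ i, q i ∈ Tp ∪ Tm) → ∀ i, ∀ u ∈ Tp, q i ∈ Tm →
      Y q + 1 ≤ Y (Function.update q i u))
    (qp qm : J → T) (hqp : ∀ i, qp i ∈ Tp) (hqm : ∀ i, qm i ∈ Tm)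
    (σ σ' : J → Bool) (hle : ∀ i, σ i ≤ σ' i) (j : ℤ)
    (hσ : Y (fun i => if σ i then qp i else qm i) = j)
    (hσ' : Y (fun i => if σ' i then qp i else qm i) = j) : σ = σ' := by
  have h := fam_mix_chain hmono qp qm hqp hqm _ σ σ' hle rfl
  have hk : (Finset.univ.filter fun i => σ i ≠ σ' i).card = 0 := by omega
  funext i
  by_contra hne
  have hi : i ∈ Finset.univ.filter fun i => σ i ≠ σ' i := by simpa using hne
  rw [Finset.card_eq_zero.1 hk] at hi
  simp at hi

/-- **Weighted antichain bound, product form.** The antichain hypothesis (for `Fin N`, weights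
`pᵢ ∈ [ε, 1-ε]`) in product form over any finite index type: for real weights `wᵢ(tt), wᵢ(ff)`
with `wᵢ(tt) + wᵢ(ff) > 0` and `wᵢ(tt)/(wᵢ(tt)+wᵢ(ff)) ∈ [ε, 1-ε]`, every antichain `𝒜` of
patterns has `∑_{σ ∈ 𝒜} ∏ᵢ wᵢ(σᵢ) ≤ C/√(|J|+1) · ∏ᵢ (wᵢ tt + wᵢ ff)`. -/
theorem fam_antichain_product :
    ∀ {J : Type*} [Fintype J] [DecidableEq J] {ε C : ℝ},
      (∀ (N : ℕ) (p : Fin N → ℝ), (∀ i, ε ≤ p i ∧ p i ≤ 1 - ε) →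
        ∀ 𝒜 : Finset (Fin N → Bool), (∀ s ∈ 𝒜, ∀ s' ∈ 𝒜, (∀ i, s i ≤ s' i) → s = s') →
          ∑ s ∈ 𝒜, ∏ i, (if s i then p i else 1 - p i) ≤ C / Real.sqrt (N + 1)) →
      ∀ (w : J → Bool → ℝ), (∀ i, 0 < w i true + w i false) →
      (∀ i, ε ≤ w i true / (w i true + w i false) ∧
        w i true / (w i true + w i false) ≤ 1 - ε) →
      ∀ 𝒜 : Finset (J → Bool), (∀ s ∈ 𝒜, ∀ s' ∈ 𝒜, (∀ i, s i ≤ s' i) → s = s') →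
      ∑ σ ∈ 𝒜, ∏ i, w i (σ i) ≤
        C / Real.sqrt (Fintype.card J + 1) * ∏ i, (w i true + w i false) := by
  intro J _ _ ε C hAC w hpos hp 𝒜 h𝒜
  -- adapted from `spread_lo_product` (…SpreadPattern.lean)
  set n := Fintype.card J with hn
  set e : J ≃ Fin n := Fintype.equivFin J with he
  set tot : J → ℝ := fun i => w i true + w i false with htot
  set r : J → Bool → ℝ := fun i b => w i b / tot i with hr
  set p : Fin n → ℝ := fun m => r (e.symm m) true with hpdef
  have hr1 : ∀ i, r i false = 1 - r i true := fun i => by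
    have h0 : tot i ≠ 0 := (hpos i).ne'
    simp only [hr, htot] at h0 ⊢
    field_simp
    ring
  have hwr : ∀ i b, w i b = tot i * r i b := fun i b => by
    have h0 : tot i ≠ 0 := (hpos i).ne'
    simp only [hr]
    field_simp
  have hfac : ∀ σ : J → Bool, ∏ i, w i (σ i) = (∏ i, tot i) * ∏ i, r i (σ i) := fun σ => by
    rw [← Finset.prod_mul_distrib]
    exact Finset.prod_congr rfl fun i _ => hwr i (σ i)
  have hL : ∑ σ ∈ 𝒜, ∏ i, w i (σ i) = (∏ i, tot i) * ∑ σ ∈ 𝒜, ∏ i, r i (σ i) := by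
    rw [Finset.mul_sum]
    exact Finset.sum_congr rfl fun σ _ => hfac σ
  -- transport the antichain to `Fin n`
  set f : (J → Bool) ≃ (Fin n → Bool) := e.arrowCongr (Equiv.refl Bool) with hf
  have hs : ∀ σ m, f σ m = σ (e.symm m) := fun σ m => rfl
  set 𝒜' : Finset (Fin n → Bool) := 𝒜.map f.toEmbedding with h𝒜'
  have h𝒜'anti : ∀ s ∈ 𝒜', ∀ s' ∈ 𝒜', (∀ m, s m ≤ s' m) → s = s' := by
    intro s hs₁ s' hs'₁ hle
    rw [h𝒜', Finset.mem_map] at hs₁ hs'₁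
    obtain ⟨σ, hσ, rfl⟩ := hs₁
    obtain ⟨σ', hσ', rfl⟩ := hs'₁
    have hσσ : σ = σ' := h𝒜 σ hσ σ' hσ' fun i => by
      have h1 := hle (e i)
      change σ (e.symm (e i)) ≤ σ' (e.symm (e i)) at h1
      rwa [Equiv.symm_apply_apply] at h1
    rw [hσσ]
  have hAC' := hAC n p (fun m => hp (e.symm m)) 𝒜' h𝒜'anti
  have htrans : ∑ σ ∈ 𝒜, ∏ i, r i (σ i) =
      ∑ s ∈ 𝒜', ∏ i, (if s i then p i else 1 - p i) := by
    rw [h𝒜', Finset.sum_map]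
    refine Finset.sum_congr rfl fun σ _ => ?_
    rw [Equiv.coe_toEmbedding]
    simp only [hs, hpdef]
    refine Fintype.prod_equiv e _ _ fun i => ?_
    simp only [Equiv.symm_apply_apply]
    cases σ i
    · simp [hr1]
    · simp
  have htotpos : 0 < ∏ i, tot i := Finset.prod_pos fun i _ => hpos i
  rw [hL, htrans, mul_comm]
  exact mul_le_mul_of_nonneg_right hAC' htotpos.le

end Summit.QuantumFields.QCD.Cruxes.WindowExtinction.FreeVolumeHeavyWitness
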